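import Summits.Ventures.PercRepro.ExcessOneProjection

/-!
# The trace identity of an excess-one family as an edge count

For a family `F` and an element `a`, the `a`-edges of `F` are the pairs `A, insert a A` of members
(`partner a F` counts them) and the `a`-edges of the difference family `F \\ F` are the pairs
`E, insert a E` of differences (`diffsX a F ∩ diffsY a F` counts them). The two counts
`card_eq_card_proj_add_card_partner` and `card_diffs_eq_card_diffs_proj_add` give
`exc(F) − exc(proj a F) = #(a-edges of F \\ F) − #(a-edges of F)`.

**Theorem.** For an excess-one family (`|F \\ F| = |F| + 1`) the projection along `a` is tight
iff `F \\ F` has exactly one more `a`-edge than `F` (`tight_proj_iff_card_edges`); in general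
`#(a-edges of F) ≤ #(a-edges of F \\ F) ≤ #(a-edges of F) + 1` (`card_partner_le_card_edges_diffs`,
`card_diffsX_inter_diffsY_le_of_card_diffs_eq`). Summed over `a` this is the statement of
proofs/MINE1-theoremS.md Addendum 29: the number of elements with a tight trace equals the
difference of the total cube-edge counts of `F \\ F` and `F` (Conjecture (TT): at least two).
-/

namespace PercRepro.MSTight

open Finset
open scoped FinsetFamily

variable {α : Type*} [DecidableEq α]

/-- The `a`-edges of `F` are at most the `a`-edges of `F \\ F`: the differences of the partner
family inject into the `a`-pairs of `F \\ F` (Marica–Schönheim on `partner a F`). -/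
theorem card_partner_le_card_edges_diffs (a : α) (F : Finset (Finset α)) :
    (partner a F).card ≤ (diffsX a F ∩ diffsY a F).card :=
  (Finset.card_le_card_diffs (partner a F)).trans (card_le_card (diffs_partner_subset a F))

/-- **The trace identity as an edge count.** For an excess-one family, the projection along `a` is
tight iff `F \\ F` has exactly one more `a`-edge than `F`. -/
theorem tight_proj_iff_card_edges {F : Finset (Finset α)} (hF : (F \\ F).card = F.card + 1)
    (a : α) :
    Tight (proj a F) ↔ (diffsX a F ∩ diffsY a F).card = (partner a F).card + 1 := by
  have h1 := card_diffs_eq_card_diffs_proj_add a F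
  have h2 := card_eq_card_proj_add_card_partner a F
  unfold Tight
  omega

/-- For an excess-one family the projection along `a` has excess at most one, and it has excess
exactly one iff the `a`-edge counts of `F \\ F` and `F` agree. -/
theorem card_diffs_proj_eq_iff {F : Finset (Finset α)} (hF : (F \\ F).card = F.card + 1)
    (a : α) :
    (proj a F \\ proj a F).card = (proj a F).card + 1 ↔
      (diffsX a F ∩ diffsY a F).card = (partner a F).card := by
  have h1 := card_diffs_eq_card_diffs_proj_add a F
  have h2 := card_eq_card_proj_add_card_partner a F
  omega

end PercRepro.MSTight
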